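import Summits.ResolutionOfSingularities.ResolutionOfSingularities.Theorems.TwistCutBaseStable
import Literature.AlgebraicGeometry.Resolution.RegularLocalOrder
import HarnessLib

/-!
# LightCutLaw — decomp-res node «LightCut» (lens-6 g22, critic row 166), tree file 1/3 of the node

Content VERBATIM from the decomp-res lens-6 g22 node `HOME/decomp-res-lens-6/g22/LightCut.lean` rev 0 (pin 61988fc1,
965 l, 52 declarations, farm rc 0 · 0 sorry ·
warnings [] · axioms {propext, Classical.choice, Quot.sound}; HOME = run/shared/lean/pub/decomp-res), typed against
the LANDED tree (imports `Theorems/TwistCutBaseStable`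
+ Literature `RegularLocalOrder` + Mathlib `MvPolynomial.PDeriv` only).  Critic: CRITIC-LEDGER row 166
(2026-08-31T02:10:56Z): CLEARED — DECIDED +1 · MAP 0
(THE LIGHT LAW `not_near_of_light`, second face of the two-level chart expansion: reduced `(n+1)`-layer of
multiplicity `≤ n − 2` along `ℙ(Dir)` ⟹ no near point;
kernel, every `p` / field / `n` / `d`; EXACT hypothesis-free re-location of the lens-6 residual `E1TopNonSplit` to
`E1TopHeavy`; inhabitants on both sides).
Landing orders INBOX :684 (lens-6 g22 landing note, NODE-g22 §7 option (b)) and :690 (critic riders row 166): two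
tree nodes `LightCutLaw` (§1–§4; split at the
400-line cap into `LightCutLaw` + `LightCutLaw2`) and `LightCutCells` (§5–§6), ONE namespace
`…Theorems.LightCutClasses` (the lens's) across the files, canonical
headers, all `--kind proof --supports stmt-ResolutionOfSingularities-26971` (`MaxContactCut.SCE1NoSubDvd`); nothing
closes 26971.  All files are cone-free
(no `Theses` import).  Aside bookkeeping (row 166 / :690): ONE successor aside on the lens-6 column, `E1TopHeavy`
(home `LightCutCells`), SUPERSEDING rev 47's
`TCE1TopNonSplit := TwistCutClasses.E1TopNonSplit` (exact `e1TopNonSplit_iff_e1TopHeavy` mod {`SubfieldContactAbs`, `E 5`}); the decided cell `E1TopNonSplitLight`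
(a THEOREM mod the same two, `e1TopNonSplitLight_of_five`) and the two principality halves are NOT filed.

The lens header, verbatim:

> # LightCut — decomp-res node «LightCut» (lens-6 g22, barrier-complement carving)
>
> A KERNEL LAW on a typed sub-cell of the PERFECT-RESIDUE core of the lens-6 residual `E1TopNonSplit`
> (tree `TwistCutCells`; host route `MaxContactCut`, item 26971 `SCE1NoSubDvd ≡ E1TopNoAbs ≡ E1TopNonSplit`).
>
> NEW AXIS (second face of the parameter-adic expansion): at a closed top point `y` whose initial form is a unit times
> the `n`-th power of ONE regular parameter, `in_y f = ā·Z^n` (the purest cell; at `n = p` over a perfect residue field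
> this is every wild point), read the degree-`(n+1)` layer `Ḡ = Σ_{|e| = n+1} b̄_e T^e ∈ κ(y)[T₁, …, T_d]` of `f` on the
> exceptional divisor `ℙ^{d-1}_{κ(y)}` of the point blow-up.  The point is **LIGHT** if `Ḡ` has multiplicity `≤ n − 2`
> at every scheme point of the hyperplane `ℙ(Dir) = {Z̄ = 0}` (chartwise: for every chart `i ≠ i₀` and every prime
> `𝔮 ∋ Z` of `κ(y)[T_j : j ≠ i]`, `s·Ḡ₁ ∉ 𝔮^{n-1}` for `s ∉ 𝔮`), **HEAVY** otherwise.
>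
> * §1 generic algebra: the two-level chart expansion `π^♯ f = cᵢ^n (σa·Z'^n + cᵢ (G₁ + cᵢ b₁))`, the colon step in a
>   regular local ring, and `light_contradiction` on `B/(cᵢ) ≅ κ(y)[T]`.
> * §2 **THE LIGHT LAW** `not_near_of_light` (kernel, every characteristic, every field, every `n ≥ 1`, every `d`):
>   a light point has NO NEAR POINT.  (Nearness forces `Z' ∈ 𝔴`, then `cᵢ (G₁ + cᵢ b₁) ∈ 𝔫^n`; the local ring of the
>   blow-up at the near point is regular with `cᵢ ∉ 𝔫²` (Literature `isRsopPart_chartFamily_reesChart`), so order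
>   additivity (Literature `mul_not_mem_pow_of_not_mem_pow`) gives `G₁ + cᵢ b₁ ∈ 𝔫^{n-1}`, i.e. `s G₁ ∈ 𝔴^{n-1} + (cᵢ)`;
>   modulo `cᵢ` this contradicts lightness.)
> * §3 the point predicate `LightAt`, `noNearPointOver_of_lightAt`, and its transport along ring isomorphisms /
>   off-centre invariance `lightAt_transform_iff_of_not_mem`.
> * §4 THE ELIMINATION GENERALISED to any near-point-free, off-centre-transportable point predicate `P`
>   (`NearPointFree n P`): `elimination_aux'`, isolation `eq_singleton_of_isIrreducible'`, finiteness
>   `wildFinite_of_orderUSC'` — the g21 induction verbatim with `DiffSplitAt` replaced by `P`; instantiated at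
>   `P = DiffSplitAt ∨ LightAt`.
> * §5 THE CELLS: `TopHeavy`, `WORTopHeavy` [RESIDUAL], `WORTopNonSplitLight` [DECIDED], `E1TopHeavy`,
>   `E1TopNonSplitLight`; EXACT hyp-free carve `worTopNonSplit_iff_heavy_light` / `e1TopNonSplit_iff_heavy_light`;
>   decided chain `worTopNonSplitLight_of_orderUSC` / `worTopNonSplitLight_of_allAbs` (tree `orderUSC_holds`,
>   `baseStable_holds` discharge `OrderUSC`, `BaseStable`) and the re-location
>   `e1TopNonSplit_iff_e1TopHeavy (hSC : SubfieldContactAbs) (h5 : E 5) : E1TopNonSplit ↔ E1TopHeavy`,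
>   `e_one_iff_e1TopHeavy (hSC) (h5) : E 1 ↔ E1TopHeavy`; §5b the 0-priced bookkeeping carve of the residual by
>   PRINCIPALITY of the initial form (`E1TopHeavy ↔ E1TopHeavyNonPrincipal ∧ E1TopHeavyPrincipal`).
> * §6 INHABITANT CERTIFICATES: `light_fermat` (the Fermat layer `1 + U^{p+1} + W^{p+1}` is light for `p ≥ 3`:
>   decided side, g21's residual inhabitant (R1) `z^p + t^{p+1} + u^{p+1} + w^{p+1}` over `𝔽_p`), `heavy_quartic`
>   (the layer `T⁴ + W²` of `z³ + t⁴ + u²w²` over `𝔽₃` in the `u`-chart violates the light condition at the origin: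
>   the residual side; that origin IS a near point — sharpness), `light_two_iff` (at `n = 2` the light cell is EMPTY:
>   DELIMITER, the increment rests on `n = p ≥ 3`).
>
> REMARK (what LIGHT constrains).  A monomial of the `(n+1)`-layer divisible by `Z^{n-1}` reduces, modulo `cᵢ`, to a
> multiple of `Z̄^{n-1} ∈ 𝔮^{n-1}` for every prime `𝔮 ∋ Z̄`; so lightness is a condition on `Ḡ₁ mod Z̄^{n-1}` only, and
> for `n ≥ 3` on the pair (`Ḡ₁|_{Z̄=0}`, `∂_{Z̄}Ḡ₁|_{Z̄=0}`, …) up to order `n − 2` in `Z̄` — in particular a layer of the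
> shape `Z^{n-1}·q + Z^n·ℓ` is automatically heavy wherever the rest of `Ḡ₁` has multiplicity `≥ n − 1`.
>
> PRESEARCH / DEDUP (tree near-point Literature, signatures read 2026-08-31): `NearPointHyperplane`
> (`Cutkosky2009_L5_1_pointHyperplane`: `d = 3`, `MvPowerSeries (Fin 3) k`, hypersurface of order `r`, conclusion
> `ℓ ∈ (u₁,u₂) + 𝔪²` — the completed `d = 3` form of the FIRST step «near ⇒ the directrix parameter lies in 𝔴»),
> `NearPointsPointCentre` (`exists_chartResidueMap_forall_initialForms_near`: `spanFinrank = 3`, a residue map of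
> the chart ring killing `𝔪` under the nearness hypothesis on ALL initial forms), `NearPointTauMonotone`
> (`IsBlowup.exists_origin_chart_of_isNear_point`: `spanFinrank = 3`, `stalkTau = 2`, typed over `IsNear`),
> `Hironaka1970NearPoint{NormalCone,InvariantCone,…}` (`Hironaka1970_thmIV(_point)` as named `Prop`s),
> `CharPolyhedronDelta(Positive)` (`delta`, `deltaL`, `deltaGE_one_pos_iff_forall_mem` for ONE-variable `S[X]`).
> None is stated for arbitrary `d` over `IdealSheafData`/`MarkedIdeal` with the Rees-chart stalk API used by the
> g21 elimination, and none reads the SECOND face; so the first step is re-done here in three lines (primality of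
> `𝔫` applied to `σa·χ(Z')^n ∈ 𝔫`, `σa` a unit) inside `light_law_local`, and everything after it (two-level
> expansion, colon by `cᵢ`, reduction mod `cᵢ`, symbolic-power reading at a possibly NON-closed `𝔮`) is new content.
> In print: «any point near to x lies on ℙ(Dir_x)» is CJS LNM 2270 Thm 3.14 (quoted p. 129, with the hypothesis
> `char κ(x) = 0 ∨ char κ(x) ≥ dim X/2 + 1` that the one-form directrix cell `in f = ā Z^n` does not need), and the
> complete (very-)nearness criterion `δ(f', y', u') ≥ 1` is CJS Thm 9.6 (p. 136) — the light law is the sufficient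
> half of that criterion read on the `(n+1)`-face alone, for ideals of any codimension-one presentation, in Lean.
>
> (Sources: Hironaka 1967 (characteristic polyhedra), CossartJannsenSaito2020 Def. 3.13 / Thm. 3.14, CossartPiltant2008
> §2, Giraud1975, EGAIV4 §16, StacksProject 0804 / 0BIQ, DeJong1996 2.4, ZariskiSamuel1960 VIII §1, Matsumura1987
> §14/§17.)

## This file

§1–§4 of the node (30 declarations; continued in `LightCutLaw2` where the 400-line cap cuts): §1 generic algebra
(`section Steps`: the two-level chart expansion `chart_expansion₂`, the colon step `mem_pow_pred_of_mul_mem_pow` in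
a regular local ring, `light_contradiction` on `B/(cᵢ) ≅ κ(y)[T]`, the abstract-localisation core
`light_law_local`); §2 **THE LIGHT LAW `not_near_of_light`** (`section Law`, scheme level: `IsBlowup π C`, `X`
regular, `C` a regular point centre, `controlledTransform`; a LIGHT top point has NO NEAR POINT — kernel, every
characteristic / field / `n ≥ 1` / `d`); §3 the point predicate `IsLight` / `LightAt`, `noNearPointOver_of_lightAt`
(+ `_of_split_or_light`), the transports `mapEquiv_layer` / `light_transport` / `lightAt_transform_iff_of_not_mem` /
`splitOrLight_transform_iff_of_not_mem`; §4 THE GENERALISED ELIMINATION for any near-point-free,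
off-centre-transportable point predicate (`NearPointFree` + its three instances, `isDatum_transform_point'`,
`wild_transform'`, `elimination_aux'`, `eq_singleton_of_isIrreducible'`, `wildFinite_of_orderUSC'`,
`wildElimination_of_nearPointFree`) — the g21 `TwistCutElimination` induction with `DiffSplitAt` replaced by `P`
(primed names, this node's namespace; the tree's unprimed g21 theorems are the `P = DiffSplitAt` instances and stay
where they are).  (This first part carries: `chart_expansion₂`, `mem_pow_pred_of_mul_mem_pow`,
`light_contradiction`, `light_law_local`, `not_near_of_light`.)

[WRITER NOTE (decomp-res writer g10): file split only (tree files ≤ 400 lines); namespace, universe, sections,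
section variables / opens and every
declaration exactly as in the lens (the lens's global dupNamespace-linter line is dropped — the library sets it;
`set_option … in` prefixes of single declarations are kept).]

(Sources: Hironaka 1967 (characteristic polyhedra); CossartJannsenSaito2020 Def. 3.13 / Thm. 3.14 (p. 129) / Thm.
9.6 (p. 136); CossartPiltant2008 §2; Giraud1975; EGAIV4 §16; StacksProject 0804 / 0BIQ; DeJong1996 2.4;
ZariskiSamuel1960 VIII §1; Matsumura1987 §14/§17.)
-/

noncomputable section

open CategoryTheory AlgebraicGeometry TopologicalSpace IsLocalRing
open Literature.AlgebraicGeometry.Resolution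

universe u

namespace Summit.ResolutionOfSingularities.ResolutionOfSingularities.Theorems.LightCutClasses

open Summit.ResolutionOfSingularities.ResolutionOfSingularities.Theorems.TwistCutClasses

section Steps

/-! ## §1 Generic algebra: two-level chart expansion, colon step, the contradiction modulo `cᵢ` -/

/-- TWO-LEVEL CHART EXPANSION: if `f ≡ a c_{i₀}^n + Σ_{|e| = n+1} b_e c^e (mod (c)^{n+2})` then on the chart `D₊(cᵢ t)`
`σ f = σ(cᵢ)^n · (σ a · χ(e_{i₀})^n + σ(cᵢ) (χ G₁ + σ(cᵢ) χ b₁))`, `G₁ = Σ φ(b_e) ∏_{j ≠ i} e_j^{e_j}`, for any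
`χ : Bᵢ → S` over `σ : R → S`. [folklore; StacksProject 0804] [folklore] -/
theorem chart_expansion₂ {R S : Type*} [CommRing R] [CommRing S] {d : ℕ} (c : Fin d → R) (i : Fin d)
    (σ : R →+* S) (χ : chartRing c i →+* S) (hχ : ∀ r, χ (chartBase c i r) = σ r)
    {n : ℕ} {f : R} (i₀ : Fin d) (a : R) (E : Finset (Fin d → ℕ)) (hE : ∀ e ∈ E, ∑ j, e j = n + 1)
    (b : (Fin d → ℕ) → R)
    (hfa : f - a * c i₀ ^ n - ∑ e ∈ E, b e * ∏ j, c j ^ e j ∈ Ideal.span (Set.range c) ^ (n + 2)) :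
    ∃ b₁ : chartRing c i, σ f = σ (c i) ^ n *
      (σ a * χ (chartGen c i i₀) ^ n + σ (c i) *
        (χ (∑ e ∈ E, chartBase c i (b e) * monProd (fun j : {j : Fin d // j ≠ i} => chartGen c i j.1) (fun j => e j.1)) +
          σ (c i) * χ b₁)) := by
  classical
  obtain ⟨b₁, hb₁⟩ := Ideal.mem_span_singleton'.mp
    (map_pow_span_le (chartBase c i) c i (fun r hr => reesChartBase_mem_span_of_mem c i hr) (n + 2)
      (Ideal.mem_map_of_mem (chartBase c i) hfa))
  refine ⟨b₁, ?_⟩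
  have hg : ∀ j, chartBase c i (c j) = chartBase c i (c i) * chartGen c i j := fun j =>
    reesChartBase_apply_eq_mul_chartGen c i j
  have hterm : ∀ e ∈ E, chartBase c i (b e * ∏ j, c j ^ e j) =
      chartBase c i (b e) * (chartBase c i (c i ^ (n + 1)) *
        monProd (fun j : {j : Fin d // j ≠ i} => chartGen c i j.1) (fun j => e j.1)) :=
    fun e he => (map_mul (chartBase c i) _ _).trans
      (congrArg (fun w => chartBase c i (b e) * w) (chartBase_prod_pow c i e (hE e he)))
  have hχt : ∀ m : ℕ, χ (chartBase c i (c i ^ m)) = σ (c i) ^ m := fun m => by rw [hχ, map_pow]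
  have hS : σ (∑ e ∈ E, b e * ∏ j, c j ^ e j) = σ (c i) ^ (n + 1) *
      χ (∑ e ∈ E, chartBase c i (b e) * monProd (fun j : {j : Fin d // j ≠ i} => chartGen c i j.1) (fun j => e j.1)) := by
    rw [← hχ]
    simp only [map_sum, Finset.mul_sum]
    refine Finset.sum_congr rfl fun e he => ?_
    rw [hterm e he, map_mul, map_mul, map_mul, hχt]; ring
  have hA : σ (a * c i₀ ^ n) = σ (c i) ^ n * (σ a * χ (chartGen c i i₀) ^ n) := by
    rw [map_mul, map_pow, ← hχ (c i₀), hg i₀, map_mul, hχ]; ring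
  have hr : σ (f - a * c i₀ ^ n - ∑ e ∈ E, b e * ∏ j, c j ^ e j) = σ (c i) ^ n * (σ (c i) * (σ (c i) * χ b₁)) := by
    rw [← hχ (f - _ - _), ← hb₁, map_mul, hχt]; ring
  have h1 : σ f = σ (a * c i₀ ^ n) + σ (∑ e ∈ E, b e * ∏ j, c j ^ e j) +
      σ (f - a * c i₀ ^ n - ∑ e ∈ E, b e * ∏ j, c j ^ e j) := by
    rw [← map_add, ← map_add]; congr 1; ring
  rw [h1, hS, hA, hr]; ring

/-- THE COLON STEP in a regular local ring: `t ∉ 𝔫²`, `t x ∈ 𝔫^n ⟹ x ∈ 𝔫^{n-1}` (order additivity,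
ZariskiSamuel1960 VIII §1 Thm. 1 = Literature `mul_not_mem_pow_of_not_mem_pow`). [folklore] -/
theorem mem_pow_pred_of_mul_mem_pow {L : Type u} [CommRing L] [IsRegularLocalRing L] {t x : L}
    (ht : t ∉ maximalIdeal L ^ 2) {n : ℕ} (h : t * x ∈ maximalIdeal L ^ n) : x ∈ maximalIdeal L ^ (n - 1) := by
  rcases Nat.lt_or_ge n 2 with hn | hn
  · have : n - 1 = 0 := by omega
    rw [this, pow_zero, Ideal.one_eq_top]; exact Submodule.mem_top
  · obtain ⟨m, rfl⟩ : ∃ m, n = m + 2 := ⟨n - 2, by omega⟩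
    by_contra hx
    rw [show m + 2 - 1 = m + 1 from by omega] at hx
    exact mul_not_mem_pow_of_not_mem_pow (p := 1) (q := m) ht hx (by rwa [show 1 + m + 1 = m + 2 from by omega])

/-- STEP 3 of the light law (on `B/(cᵢ) ≅ κ[T_j : j ≠ i]`, `polyChartEquiv`): a LIGHT layer forbids
`s G₁ ∈ 𝔴^m + (cᵢ)` with `s ∉ 𝔴 ∋ cᵢ, e_{i₀}` (`m = n − 1`). [new; tools: StacksProject 0BIQ (`chartQuotEquiv`)] [folklore] -/
theorem light_contradiction {R : Type*} [CommRing R] [IsLocalRing R] {d : ℕ} (c : Fin d → R) (i : Fin d)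
    (hc : Ideal.span (Set.range c) = maximalIdeal R) (hqr : IsQuasiRegular c)
    {m : ℕ} (E : Finset (Fin d → ℕ)) (b : (Fin d → ℕ) → R) {i₀ : Fin d} (hi : i₀ ≠ i)
    (hlight : ∀ 𝔮 : Ideal (MvPolynomial {j : Fin d // j ≠ i} (ResidueField R)), 𝔮.IsPrime →
      MvPolynomial.X (⟨i₀, hi⟩ : {j : Fin d // j ≠ i}) ∈ 𝔮 → ∀ s ∉ 𝔮,
        s * (∑ e ∈ E, MvPolynomial.monomial (restrictExp i e) (residue R (b e))) ∉ 𝔮 ^ m)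
    (𝔴 : Ideal (chartRing c i)) [𝔴.IsPrime] (hK𝔴 : chartBase c i (c i) ∈ 𝔴) (hZ𝔴 : chartGen c i i₀ ∈ 𝔴)
    {s : chartRing c i} (hs : s ∉ 𝔴)
    (hsG : s * (∑ e ∈ E, chartBase c i (b e) * monProd (fun j : {j : Fin d // j ≠ i} => chartGen c i j.1) (fun j => e j.1)) ∈
      𝔴 ^ m ⊔ Ideal.span {chartBase c i (c i)}) : False := by
  classical
  obtain ⟨G, hG⟩ : ∃ G : chartRing c i,
      G = ∑ e ∈ E, chartBase c i (b e) * monProd (fun j : {j : Fin d // j ≠ i} => chartGen c i j.1) (fun j => e j.1) :=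
    ⟨_, rfl⟩
  obtain ⟨K𝔷, hK𝔷⟩ : ∃ K𝔷 : Ideal (chartRing c i), K𝔷 = Ideal.span {chartBase c i (c i)} := ⟨_, rfl⟩
  rw [← hG, ← hK𝔷] at hsG
  have hK𝔴' : K𝔷 ≤ 𝔴 := by rw [hK𝔷, Ideal.span_singleton_le_iff_mem]; exact hK𝔴
  haveI hQp : (𝔴.map (Ideal.Quotient.mk K𝔷)).IsPrime :=
    Ideal.map_isPrime_of_surjective Ideal.Quotient.mk_surjective (by rw [Ideal.mk_ker]; exact hK𝔴')
  have hsQ : Ideal.Quotient.mk K𝔷 s ∉ 𝔴.map (Ideal.Quotient.mk K𝔷) := by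
    rw [Ideal.mem_quotient_iff_mem_sup, sup_eq_left.mpr hK𝔴']; exact hs
  have hZQ : Ideal.Quotient.mk K𝔷 (chartGen c i i₀) ∈ 𝔴.map (Ideal.Quotient.mk K𝔷) := Ideal.mem_map_of_mem _ hZ𝔴
  have hsGQ : Ideal.Quotient.mk K𝔷 s * Ideal.Quotient.mk K𝔷 G ∈ (𝔴.map (Ideal.Quotient.mk K𝔷)) ^ m := by
    rw [← map_mul]
    have := Ideal.mem_map_of_mem (Ideal.Quotient.mk K𝔷) hsG
    rwa [Ideal.map_sup, Ideal.map_pow, Ideal.map_quotient_self, sup_bot_eq] at this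
  subst hK𝔷
  -- pull everything back to `κ[T_j : j ≠ i]` along `ε = polyChartEquiv`
  obtain ⟨ε, hε⟩ : ∃ ε : MvPolynomial {j : Fin d // j ≠ i} (ResidueField R) ≃+*
      (chartRing c i ⧸ Ideal.span {chartBase c i (c i)}), ε = polyChartEquiv c i hc hqr := ⟨_, rfl⟩
  have hεG : ε (∑ e ∈ E, MvPolynomial.monomial (restrictExp i e) (residue R (b e))) = Ideal.Quotient.mk _ G := by
    rw [hG, hε]; exact polyChartEquiv_sum c i hc hqr E b
  have hεX : ε (MvPolynomial.X ⟨i₀, hi⟩) = Ideal.Quotient.mk _ (chartGen c i i₀) := by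
    rw [hε]; exact polyChartEquiv_X c i hc hqr ⟨i₀, hi⟩
  obtain ⟨𝔮, h𝔮⟩ : ∃ 𝔮 : Ideal (MvPolynomial {j : Fin d // j ≠ i} (ResidueField R)),
      𝔮 = (𝔴.map (Ideal.Quotient.mk (Ideal.span {chartBase c i (c i)}))).map (ε.symm : _ →+* _) := ⟨_, rfl⟩
  haveI : 𝔮.IsPrime := by rw [h𝔮]; exact Ideal.map_isPrime_of_equiv _
  have hX𝔮 : MvPolynomial.X (⟨i₀, hi⟩ : {j : Fin d // j ≠ i}) ∈ 𝔮 := by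
    rw [h𝔮, ← ε.symm_apply_apply (MvPolynomial.X _), hεX]
    exact (mem_map_iff_of_equiv ε.symm _ _).2 hZQ
  have hs𝔮 : ε.symm (Ideal.Quotient.mk _ s) ∉ 𝔮 := by
    rw [h𝔮]; exact fun h => hsQ ((mem_map_iff_of_equiv ε.symm _ _).1 h)
  refine hlight 𝔮 inferInstance hX𝔮 _ hs𝔮 ?_
  rw [← ε.symm_apply_apply (∑ e ∈ E, _), hεG, ← map_mul, h𝔮, ← Ideal.map_pow]
  exact (mem_map_iff_of_equiv ε.symm _ _).2 hsGQ

/-- **THE LIGHT LAW, local-algebra form** (abstract chart datum: `R` regular local with regular system of parameters `c`,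
`𝔴` a prime of the chart ring `Bᵢ` over `𝔪_R`, `L` a localisation of `Bᵢ` at `𝔴`, `σ = χ ∘ φ`).  If the layer is light in
chart `i` (for `i ≠ i₀`) and `a` is a unit, then `σ a · χ(e_{i₀})^n + σ(cᵢ) (χ G₁ + σ(cᵢ) χ b₁) ∉ 𝔫_L^n`.
[new; tools: DeJong1996 2.4 (`isRsopPart_chartFamily_reesChart`), ZariskiSamuel1960 VIII §1, StacksProject 0BIQ] [folklore] -/
theorem light_law_local {R : Type u} [CommRing R] [IsRegularLocalRing R] {d : ℕ} (c : Fin d → R) (i : Fin d)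
    (hd : (maximalIdeal R).spanFinrank = d) (hc : Ideal.span (Set.range c) = maximalIdeal R)
    (𝔴 : Ideal (chartRing c i)) [𝔴.IsPrime] (h𝔴 : 𝔴.comap (chartBase c i) = maximalIdeal R)
    (L : Type u) [CommRing L] [IsLocalRing L] (σ : R →+* L) (χ : chartRing c i →+* L)
    (hχ : ∀ r, χ (chartBase c i r) = σ r) (hloc : @IsLocalization.AtPrime _ _ L _ χ.toAlgebra 𝔴 _)
    {n : ℕ} (hn : 1 ≤ n) (i₀ : Fin d) {a : R} (ha : a ∉ maximalIdeal R) (E : Finset (Fin d → ℕ)) (b : (Fin d → ℕ) → R)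
    (hlight : ∀ (hi : i₀ ≠ i) (𝔮 : Ideal (MvPolynomial {j : Fin d // j ≠ i} (ResidueField R))), 𝔮.IsPrime →
      MvPolynomial.X (⟨i₀, hi⟩ : {j : Fin d // j ≠ i}) ∈ 𝔮 → ∀ s ∉ 𝔮,
        s * (∑ e ∈ E, MvPolynomial.monomial (restrictExp i e) (residue R (b e))) ∉ 𝔮 ^ (n - 1))
    (b₁ : chartRing c i)
    (hw : σ a * χ (chartGen c i i₀) ^ n + σ (c i) *
      (χ (∑ e ∈ E, chartBase c i (b e) * monProd (fun j : {j : Fin d // j ≠ i} => chartGen c i j.1) (fun j => e j.1)) +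
        σ (c i) * χ b₁) ∈ maximalIdeal L ^ n) : False := by
  classical
  obtain ⟨G, hG⟩ : ∃ G : chartRing c i,
      G = ∑ e ∈ E, chartBase c i (b e) * monProd (fun j : {j : Fin d // j ≠ i} => chartGen c i j.1) (fun j => e j.1) :=
    ⟨_, rfl⟩
  rw [← hG] at hw
  letI alg : Algebra (chartRing c i) L := χ.toAlgebra
  haveI : IsLocalization.AtPrime L 𝔴 := hloc
  have halg : ∀ w, algebraMap (chartRing c i) L w = χ w := fun w => by rw [RingHom.algebraMap_toAlgebra]
  -- membership in `𝔫_L` is read off on the chart ring / downstairs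
  have hmem𝔴 : ∀ w : chartRing c i, χ w ∈ maximalIdeal L ↔ w ∈ 𝔴 := fun w => by
    rw [← halg]; exact IsLocalization.AtPrime.to_map_mem_maximal_iff L 𝔴 w
  have hmemσ : ∀ r, σ r ∈ maximalIdeal L ↔ r ∈ maximalIdeal R := fun r => by
    rw [← hχ, hmem𝔴, ← Ideal.mem_comap, h𝔴]
  have ht : σ (c i) ∈ maximalIdeal L := by rw [hmemσ, ← hc]; exact Ideal.subset_span ⟨i, rfl⟩
  have hσa : σ a ∉ maximalIdeal L := by rw [hmemσ]; exact ha
  have hw₁ : σ a * χ (chartGen c i i₀) ^ n + σ (c i) * (χ G + σ (c i) * χ b₁) ∈ maximalIdeal L :=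
    Ideal.pow_le_self (by omega) hw
  have haZ : σ a * χ (chartGen c i i₀) ^ n ∈ maximalIdeal L := by
    have h1 := sub_mem hw₁ (Ideal.mul_mem_right (χ G + σ (c i) * χ b₁) _ ht)
    rwa [add_sub_cancel_right] at h1
  by_cases hi : i₀ = i
  · -- chart `i₀`: the transform is a unit
    subst hi
    have hii : chartGen c i₀ i₀ = 1 := chartGen_self c i₀
    rw [hii, map_one, one_pow, mul_one] at haZ
    exact hσa haZ
  · -- chart `i ≠ i₀`: `e_{i₀} ∈ 𝔴`
    have hZ : χ (chartGen c i i₀) ∈ maximalIdeal L :=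
      Ideal.IsPrime.mem_of_pow_mem inferInstance n ((Ideal.IsPrime.mem_or_mem inferInstance haZ).resolve_left hσa)
    have hZ𝔴 : chartGen c i i₀ ∈ 𝔴 := (hmem𝔴 _).1 hZ
    -- `t (χ G + t χ b₁) ∈ 𝔫^n`
    have htx : σ (c i) * (χ G + σ (c i) * χ b₁) ∈ maximalIdeal L ^ n := by
      have h1 : σ a * χ (chartGen c i i₀) ^ n ∈ maximalIdeal L ^ n := Ideal.mul_mem_left _ _ (Ideal.pow_mem_pow hZ n)
      have h2 := sub_mem hw h1
      rwa [add_sub_cancel_left] at h2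
    -- `L` is regular and `t ∉ 𝔫²` (Literature `isRsopPart_chartFamily_reesChart`, DeJong1996 2.4)
    have hz : Ideal.span (Set.range (Fin.append c (Fin.elim0 : Fin 0 → R))) = maximalIdeal R := by
      have hr : Set.range (Fin.append c (Fin.elim0 : Fin 0 → R)) = Set.range c := by
        rw [Fin.append_elim0]
        ext x
        constructor
        · rintro ⟨k, rfl⟩; exact ⟨_, rfl⟩
        · rintro ⟨k, rfl⟩; exact ⟨Fin.cast (Nat.add_zero d).symm k, rfl⟩
      rw [hr]; exact hc
    have hrs := isRsopPart_chartFamily_reesChart c i (Fin.elim0 : Fin 0 → R) hz hd 𝔴 h𝔴 L (a := 0)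
      (fun k => Fin.elim0 k) (Function.injective_of_subsingleton _) fun k => Fin.elim0 k
    haveI : IsRegularLocalRing L := hrs.isRegularLocalRing
    have ht2 : σ (c i) ∉ maximalIdeal L ^ 2 := by
      have h1 := hrs.not_mem_sq 0
      have h2 : chartFamily c i (Fin.elim0 : Fin 0 → R) L (chartBase c i) (chartGen c i) (fun k => Fin.elim0 k) 0 =
          σ (c i) := by
        rw [chartFamily, Fin.cons_zero, halg, hχ]
      rwa [h2] at h1
    have hx : χ G + σ (c i) * χ b₁ ∈ maximalIdeal L ^ (n - 1) := mem_pow_pred_of_mul_mem_pow ht2 htx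
    -- STEP 2: `s G ∈ 𝔴^{n-1} + (cᵢ)`, `s ∉ 𝔴`
    obtain ⟨s, hs, hsG⟩ := exists_mul_mem_sup_of_localization (S := L) 𝔴 G (chartBase c i (c i)) (χ b₁)
      (χ G + σ (c i) * χ b₁) (by rw [halg, halg, hχ]; ring) hx
    -- STEP 3: modulo `cᵢ`
    have hK𝔴 : chartBase c i (c i) ∈ 𝔴 := by
      rw [← Ideal.mem_comap, h𝔴, ← hc]
      exact Ideal.subset_span ⟨i, rfl⟩
    rw [hG] at hsG
    exact light_contradiction c i hc (isQuasiRegular_rsop_comp hd c hc id Function.injective_id) E b hi (hlight hi)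
      𝔴 hK𝔴 hZ𝔴 hs hsG

end Steps

section Law

variable {X X' : Scheme.{u}} {π : X' ⟶ X} {C : X.IdealSheafData}

/-! ## §2 THE LIGHT LAW (scheme level): a light top point has no near point -/

/-- **THE LIGHT LAW (kernel, every characteristic, every field, every `n ≥ 1`).**  Let `π : X' → X` be the blow-up of the
regular scheme `X` at the reduced closed point `x = π y` (`C` regular, `supp C = {x}`), `(c₁, …, c_d)` a regular system of
parameters at `x`, and `f ∈ 𝓘_x` with `f ≡ a·c_{i₀}^n + Σ_{e ∈ E} b_e c^e (mod 𝔪_x^{n+2})`, `a` a unit, all `|e| = n + 1`.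
Suppose the layer is LIGHT along the directrix hyperplane: for every chart `i ≠ i₀` and every prime `𝔮 ∋ T_{i₀}` of
`κ(x)[T_j : j ≠ i]`, `s·Ḡ₁ ∉ 𝔮^{n-1}` for all `s ∉ 𝔮` (`Ḡ₁ = Σ b̄_e T^{e|_{j ≠ i}}`).  Then `y` is NOT a near point:
`𝓘'_y ⊄ 𝔪_y^n` for the controlled transform `𝓘' = (π^*𝓘 : 𝓔^n)`.  (On the chart `D₊(cᵢt) ∋ y`:
`π^♯ f = cᵢ^n (σa·e_{i₀}^n + cᵢ (G₁ + cᵢ b₁))` (`chart_expansion₂`), and `light_law_local`.)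
(Sources: CossartJannsenSaito2020 Def. 3.13 / Thm. 3.14; Hironaka 1967; DeJong1996 2.4; ZariskiSamuel1960 VIII §1;
StacksProject 0804, 0BIQ.) [new] -/
theorem not_near_of_light (hπ : IsBlowup π C) (hX : Scheme.IsRegular X) (hCreg : Scheme.IsRegular C.subscheme)
    (I : X.IdealSheafData) (y : X') (hcl : IsClosed ({π.base y} : Set X)) (hpt : (C.support : Set X) = {π.base y})
    {d : ℕ} (c : Fin d → X.presheaf.stalk (π.base y)) (hd : (maximalIdeal (X.presheaf.stalk (π.base y))).spanFinrank = d)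
    (hc : Ideal.span (Set.range c) = maximalIdeal (X.presheaf.stalk (π.base y)))
    {n : ℕ} (hn : 1 ≤ n) {f : X.presheaf.stalk (π.base y)} (hfI : f ∈ stalkIdeal I (π.base y))
    (i₀ : Fin d) (a : X.presheaf.stalk (π.base y)) (ha : a ∉ maximalIdeal (X.presheaf.stalk (π.base y)))
    (E : Finset (Fin d → ℕ)) (hE : ∀ e ∈ E, ∑ j, e j = n + 1) (b : (Fin d → ℕ) → X.presheaf.stalk (π.base y))
    (hfa : f - a * c i₀ ^ n - ∑ e ∈ E, b e * ∏ j, c j ^ e j ∈ maximalIdeal (X.presheaf.stalk (π.base y)) ^ (n + 2))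
    (hlight : ∀ (i : Fin d) (hi : i₀ ≠ i)
      (𝔮 : Ideal (MvPolynomial {j : Fin d // j ≠ i} (ResidueField (X.presheaf.stalk (π.base y))))), 𝔮.IsPrime →
        MvPolynomial.X (⟨i₀, hi⟩ : {j : Fin d // j ≠ i}) ∈ 𝔮 → ∀ s ∉ 𝔮,
          s * (∑ e ∈ E, MvPolynomial.monomial (restrictExp i e) (residue _ (b e))) ∉ 𝔮 ^ (n - 1)) :
    ¬ stalkIdeal (controlledTransform π C I n) y ≤ maximalIdeal (X'.presheaf.stalk y) ^ n := by
  classical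
  intro hle
  haveI : IsRegularLocalRing (X.presheaf.stalk (π.base y)) := hX _
  -- the centre stalk is `𝔪_x`
  have hCst : stalkIdeal C (π.base y) = maximalIdeal _ := by
    rw [eq_vanishingIdeal_support_of_isRegular C hCreg]
    apply stalkIdeal_vanishingIdeal_eq_maximalIdeal_of_closure_eq
    rw [hpt, hcl.closure_eq]
  have hcC : Ideal.span (Set.range c) = stalkIdeal C (π.base y) := hc.trans hCst.symm
  -- the chart at `y`
  obtain ⟨i, 𝔴, χ, hχ, hloc, h𝔴⟩ := hπ.exists_reesChart_stalk y c hcC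
  have hg : ∀ j, chartBase c i (c j) = chartBase c i (c i) * chartGen c i j := fun j =>
    reesChartBase_apply_eq_mul_chartGen c i j
  -- `E_y = (t)`, `t = π^* cᵢ`
  have hE𝔷 : stalkIdeal (C.comap π) y = Ideal.span {(π.stalkMap y).hom (c i)} := by
    rw [stalkIdeal_comap_eq_map_stalkMap, hCst, ← hc, Ideal.map_span]
    apply le_antisymm
    · rw [Ideal.span_le]
      rintro _ ⟨_, ⟨j, rfl⟩, rfl⟩
      change (π.stalkMap y).hom (c j) ∈ Ideal.span {(π.stalkMap y).hom (c i)}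
      rw [← hχ (c j), hg j, map_mul, hχ]
      exact Ideal.mul_mem_right _ _ (Ideal.mem_span_singleton_self _)
    · rw [Ideal.span_singleton_le_iff_mem]
      exact Ideal.subset_span ⟨c i, ⟨i, rfl⟩, rfl⟩
  -- colon formula for the controlled transform
  have hI' : stalkIdeal (controlledTransform π C I n) y =
      Submodule.colon ((stalkIdeal I (π.base y)).map (π.stalkMap y).hom) {(π.stalkMap y).hom (c i) ^ n} := by
    rw [hπ.stalkIdeal_controlledTransform I n y, stalkIdeal_comap_eq_map_stalkMap, hE𝔷, Ideal.span_singleton_pow,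
      Submodule.colon_span]
  -- STEP 1: the two-level chart expansion, in `𝒪_y`
  have hfa' : f - a * c i₀ ^ n - ∑ e ∈ E, b e * ∏ j, c j ^ e j ∈ Ideal.span (Set.range c) ^ (n + 2) := by
    rw [hc]; exact hfa
  obtain ⟨b₁, hσf⟩ := chart_expansion₂ c i (π.stalkMap y).hom χ hχ i₀ a E hE b hfa'
  -- nearness: `w₁ ∈ 𝓘'_y ⊆ 𝔪_y^n`, `σ f = t^n w₁`
  have hw₁I : (π.stalkMap y).hom a * χ (chartGen c i i₀) ^ n + (π.stalkMap y).hom (c i) *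
      (χ (∑ e ∈ E, chartBase c i (b e) * monProd (fun j : {j : Fin d // j ≠ i} => chartGen c i j.1) (fun j => e j.1)) +
        (π.stalkMap y).hom (c i) * χ b₁) ∈ stalkIdeal (controlledTransform π C I n) y := by
    rw [hI', Submodule.mem_colon_singleton, smul_eq_mul, mul_comm, ← hσf]
    exact Ideal.mem_map_of_mem _ hfI
  exact light_law_local c i hd hc 𝔴.asIdeal h𝔴 (X'.presheaf.stalk y) (π.stalkMap y).hom χ hχ hloc hn i₀ ha E b
    (fun hi => hlight i hi) b₁ (hle hw₁I)

end Law

end Summit.ResolutionOfSingularities.ResolutionOfSingularities.Theorems.LightCutClasses
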